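import Literature.Topology.FourManifolds.GluckTwistSimplyConnected
import Summits.SmoothPoincare4.SmoothPoincare4.Theorems.DottedCircleRasmussenDcrGapHelperFriendsPi1G1Aux
import Summits.SmoothPoincare4.SmoothPoincare4.Theses.DottedCircleRasmussen

/-!
# Helper `helper_friendsPi1_G1`: `ℝ⁴ ∖ D_k` is simply connected
(sub-goal G1 of stub `stub_friendsPi1`, line `mk_friends`, skeleton v2, crux `DcrGap`;
item stmt-SmoothPoincare4-16128, route route-SmoothPoincare4-DottedCircleRasmussen)

`D_k = MMSW.modelHandlebody k ⊂ ℝ⁴ = ℂ_z × ℂ_w` is the model dotted handlebody (a 4-ball with `k`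
unknotted proper 2-discs carved out, `≅ ♮ᵏ(S¹ × B³)`, Kirby's dotted-circle picture); its complement
is simply connected — the statement `helper_friendsPi1_G1` consumed (as a hypothesis) by the Kervaire
step `helper_friendsPi1_G2` and the assembly of `stub_friendsPi1`.

## Proof (van Kampen, easy half, for an explicit two-set cover; no general position)

With the base point `x_far = (z_far, 3)`, `z_far = 50(k+1)`, cover `X = ℝ⁴ ∖ D_k` by
`U = X ∩ {w ≠ 0}` and `V = {(z, w) | (z, 0) ∉ D_k} ∪ {Re w > 2}`.  Part 1
(`…HelperFriendsPi1G1Aux.lean`, `helper_friendsPi1_G1_cover`) shows `U`, `V` open, `U ∪ V = X`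
and `U`, `V`, `U ∩ V` path connected.  Here:

* `loopV_null` — a loop of `V` at `x_far` dies in `X`: the straight-line push `w ↦ (1-s)w + 3s`
  keeps `V` inside `V ⊆ X` (over a free base point anything goes; `Re w > 2` is convex), then
  `z ↦ (1-s)z + s z_far` at height `w = 3`; both stages fix `x_far`.
* `loopU_null` — a loop of `U` at `x_far` dies in `X`: the radial push `w ↦ ((1-s) + 3s/|w|) w`
  raises `|w|` towards `3` (the complement is closed upwards in `|w|`, `not_mem_mono`, and
  `{|w| > 1} ⊆ X`), then `z ↦ (1-s)z + s z_far` at height `|w| = 3`, then `w ↦ (1-s)w + 3s` over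
  `z_far`, where the whole fibre misses `D_k` (`ofZW_zFar_not_mem`); all stages fix `x_far`.
* `simplyConnectedSpace_compl_modelHandlebody` — the tree's
  `simplyConnectedSpace_of_isOpen_cover_of_loops` (Hatcher, Lemma 1.15, `GluckTwistSimplyConnected`)
  assembles these; `helper_friendsPi1_G1` is its restatement on the subtype `{x // x ∉ D_k}`.

The path homotopies are written by ambient formulas `G (s, t) ∈ ℝ⁴` (`homotopic_of_ambient`).
Everything is proved; no definitions, no named facts, no `sorry`.

## References

* A. Hatcher, *Algebraic Topology* (2002), §1.2, Lemma 1.15 [HatcherAT2002].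
* R. Kirby, *The Topology of 4-Manifolds*, LNM 1374 (1989), Ch. I §2 [Kirby1989].
-/

-- the prescribed namespace `Summit.<P>.<Sub>.…` duplicates `SmoothPoincare4` (P = Sub)
set_option linter.dupNamespace false
set_option linter.style.longLine false

noncomputable section

open scoped Topology unitInterval
open Function Set
open Literature.Topology.FourManifolds Literature.Topology.FourManifolds.MMSW
open Literature.AlgebraicTopology.Homotopy.HopfFibration (zC wC ofZW zC_ofZW wC_ofZW ofZW_zC_wC
  continuous_zC continuous_wC continuous_ofZW)

namespace Summit.SmoothPoincare4.SmoothPoincare4.Theorems.DcrGap.MkFriends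

variable {k : ℕ}

/-! ## Paths and path homotopies of `ℝ⁴ ∖ D_k` from ambient formulas -/

/-- A path of `ℝ⁴ ∖ D_k` given by an ambient formula. [folklore] -/
theorem exists_path_of_fun {a b : ↥(modelHandlebody k)ᶜ} (f : I → EuclideanSpace ℝ (Fin 4))
    (hf : Continuous f) (h0 : f 0 = a) (h1 : f 1 = b) (hS : ∀ t, f t ∉ modelHandlebody k) :
    ∃ γ : Path a b, ∀ t, (γ t : EuclideanSpace ℝ (Fin 4)) = f t :=
  ⟨{ toFun := fun t => ⟨f t, hS t⟩
     continuous_toFun := hf.subtype_mk hS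
     source' := Subtype.ext h0
     target' := Subtype.ext h1 }, fun _ => rfl⟩

/-- A path homotopy of `ℝ⁴ ∖ D_k` given by an ambient formula `G (s, t)`. [folklore] -/
theorem homotopic_of_ambient {a b : ↥(modelHandlebody k)ᶜ} {γ γ' : Path a b}
    (G : I × I → EuclideanSpace ℝ (Fin 4)) (hG : Continuous G)
    (h0 : ∀ t, G (0, t) = γ t) (h1 : ∀ t, G (1, t) = γ' t)
    (ha : ∀ s, G (s, 0) = a) (hb : ∀ s, G (s, 1) = b) (hS : ∀ q, G q ∉ modelHandlebody k) :
    γ.Homotopic γ' :=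
  ⟨{ toFun := fun q => ⟨G q, hS q⟩
     continuous_toFun := hG.subtype_mk hS
     map_zero_left := fun t => Subtype.ext (h0 t)
     map_one_left := fun t => Subtype.ext (h1 t)
     prop' := fun s t ht => by
       rcases ht with ht | ht
       · subst ht
         exact Subtype.ext ((ha s).trans (congrArg Subtype.val γ.source).symm)
       · rw [Set.mem_singleton_iff] at ht
         subst ht
         exact Subtype.ext ((hb s).trans (congrArg Subtype.val γ.target).symm) }⟩

/-- `t ↦ (f t, g t)` is continuous. [folklore] -/
theorem continuous_ofZW' {T : Type*} [TopologicalSpace T] {f g : T → ℂ} (hf : Continuous f)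
    (hg : Continuous g) : Continuous fun t => ofZW (f t) (g t) :=
  continuous_ofZW.comp (hf.prodMk hg)

/-- The homotopy parameter `s : I × I → ℝ` is continuous. [folklore] -/
theorem continuous_coe_fst : Continuous fun q : I × I => ((q.1 : ℝ)) :=
  continuous_subtype_val.comp continuous_fst

/-! ## Loops of `V` and of `U` at `x_far` are null-homotopic in `ℝ⁴ ∖ D_k` -/

/-- **Loops of `V` die in `ℝ⁴ ∖ D_k`**: push `w` linearly to `3` (inside `V`), then `z` linearly to
`z_far` at height `w = 3`; both stages fix the base point `x_far = (z_far, 3)`. [folklore] -/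
theorem loopV_null
    (δ : Path (⟨ofZW ((50 * ((k : ℝ) + 1) : ℝ) : ℂ) 3, ofZW_zFar_not_mem k 3⟩ : ↥(modelHandlebody k)ᶜ)
      ⟨ofZW ((50 * ((k : ℝ) + 1) : ℝ) : ℂ) 3, ofZW_zFar_not_mem k 3⟩)
    (hδ : ∀ t, (δ t : EuclideanSpace ℝ (Fin 4)) ∈
      {x : EuclideanSpace ℝ (Fin 4) | ofZW (zC x) 0 ∉ modelHandlebody k ∨ 2 < (wC x).re}) :
    δ.Homotopic (Path.refl _) := by
  set z : I → ℂ := fun t => zC (δ t : EuclideanSpace ℝ (Fin 4)) with hz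
  set w : I → ℂ := fun t => wC (δ t : EuclideanSpace ℝ (Fin 4)) with hw
  have hzc : Continuous z := continuous_zC.comp (continuous_subtype_val.comp δ.continuous)
  have hwc : Continuous w := continuous_wC.comp (continuous_subtype_val.comp δ.continuous)
  have hδt : ∀ t, (δ t : EuclideanSpace ℝ (Fin 4)) = ofZW (z t) (w t) :=
    fun t => (ofZW_zC_wC _).symm
  have hz0 : z 0 = ((50 * ((k : ℝ) + 1) : ℝ) : ℂ) := by simp [hz]
  have hz1 : z 1 = ((50 * ((k : ℝ) + 1) : ℝ) : ℂ) := by simp [hz]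
  have hw0 : w 0 = 3 := by simp [hw]
  have hw1 : w 1 = 3 := by simp [hw]
  -- the intermediate loop `t ↦ (z t, 3)`
  obtain ⟨δ₁, hδ₁⟩ := exists_path_of_fun
    (a := ⟨ofZW ((50 * ((k : ℝ) + 1) : ℝ) : ℂ) 3, ofZW_zFar_not_mem k 3⟩)
    (b := ⟨ofZW ((50 * ((k : ℝ) + 1) : ℝ) : ℂ) 3, ofZW_zFar_not_mem k 3⟩) (fun t => ofZW (z t) 3)
    (continuous_ofZW' hzc continuous_const) (by rw [hz0]) (by rw [hz1])
    (fun t => not_mem_of_one_lt_norm_w (by norm_num))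
  have h01 : δ.Homotopic δ₁ := by
    refine homotopic_of_ambient
      (fun q => ofZW (z q.2) ((1 - (q.1 : ℝ)) • w q.2 + (q.1 : ℝ) • (3 : ℂ)))
      (continuous_ofZW' (hzc.comp continuous_snd)
        (((continuous_const.sub continuous_coe_fst).smul (hwc.comp continuous_snd)).add
          (continuous_coe_fst.smul continuous_const)))
      (fun t => by simp [hδt]) (fun t => by simp [hδ₁]) (fun s => ?_) (fun s => ?_) (fun q => ?_)
    · rw [hz0, hw0, ← add_smul, sub_add_cancel, one_smul]
    · rw [hz1, hw1, ← add_smul, sub_add_cancel, one_smul]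
    · rcases hδ q.2 with h | h
      · exact ofZW_not_mem_of_base h _
      · refine not_mem_of_one_lt_norm_w (one_lt_norm_of_two_lt_re ?_)
        simp only [wC_ofZW, Complex.add_re, Complex.smul_re, smul_eq_mul, Complex.re_ofNat]
        exact two_lt_convex (unitInterval.one_minus_nonneg q.1) q.1.2.1 (by ring) h
  have h12 : δ₁.Homotopic (Path.refl _) := by
    refine homotopic_of_ambient
      (fun q => ofZW ((1 - (q.1 : ℝ)) • z q.2 + (q.1 : ℝ) • ((50 * ((k : ℝ) + 1) : ℝ) : ℂ)) 3)
      (continuous_ofZW' (((continuous_const.sub continuous_coe_fst).smul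
        (hzc.comp continuous_snd)).add (continuous_coe_fst.smul continuous_const)) continuous_const)
      (fun t => by simp [hδ₁]) (fun t => by simp) (fun s => ?_) (fun s => ?_)
      (fun q => not_mem_of_one_lt_norm_w (by norm_num))
    · rw [hz0, ← add_smul, sub_add_cancel, one_smul]
    · rw [hz1, ← add_smul, sub_add_cancel, one_smul]
  exact h01.trans h12

/-- **Loops of `U` die in `ℝ⁴ ∖ D_k`**: push `w` radially to `|w| = 3` (inside `U`), then `z`
linearly to `z_far` at height `|w| = 3`, then `w` linearly to `3` over `z_far` (where the whole fibre
misses `D_k`); all three stages fix the base point `x_far = (z_far, 3)`. [folklore] -/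
theorem loopU_null
    (δ : Path (⟨ofZW ((50 * ((k : ℝ) + 1) : ℝ) : ℂ) 3, ofZW_zFar_not_mem k 3⟩ : ↥(modelHandlebody k)ᶜ)
      ⟨ofZW ((50 * ((k : ℝ) + 1) : ℝ) : ℂ) 3, ofZW_zFar_not_mem k 3⟩)
    (hδ : ∀ t, (δ t : EuclideanSpace ℝ (Fin 4)) ∈
      {x : EuclideanSpace ℝ (Fin 4) | x ∉ modelHandlebody k ∧ wC x ≠ 0}) :
    δ.Homotopic (Path.refl _) := by
  set z : I → ℂ := fun t => zC (δ t : EuclideanSpace ℝ (Fin 4)) with hz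
  set w : I → ℂ := fun t => wC (δ t : EuclideanSpace ℝ (Fin 4)) with hw
  have hzc : Continuous z := continuous_zC.comp (continuous_subtype_val.comp δ.continuous)
  have hwc : Continuous w := continuous_wC.comp (continuous_subtype_val.comp δ.continuous)
  have hδt : ∀ t, (δ t : EuclideanSpace ℝ (Fin 4)) = ofZW (z t) (w t) :=
    fun t => (ofZW_zC_wC _).symm
  have hz0 : z 0 = ((50 * ((k : ℝ) + 1) : ℝ) : ℂ) := by simp [hz]
  have hz1 : z 1 = ((50 * ((k : ℝ) + 1) : ℝ) : ℂ) := by simp [hz]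
  have hw0 : w 0 = 3 := by simp [hw]
  have hw1 : w 1 = 3 := by simp [hw]
  have hwne : ∀ t, w t ≠ 0 := fun t => (hδ t).2
  have hpos : ∀ t, 0 < ‖w t‖ := fun t => norm_pos_iff.2 (hwne t)
  -- the radial factor `c t = 3 / ‖w t‖`
  set c : I → ℝ := fun t => 3 / ‖w t‖ with hc
  have hcc : Continuous c := continuous_const.div (continuous_norm.comp hwc) fun t => (hpos t).ne'
  have hcpos : ∀ t, 0 < c t := fun t => div_pos (by norm_num) (hpos t)
  have hnorm : ∀ t, ‖c t • w t‖ = 3 := fun t => by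
    rw [norm_smul, Real.norm_eq_abs, abs_of_pos (hcpos t), hc]
    exact div_mul_cancel₀ _ (hpos t).ne'
  have hc0 : c 0 = 1 := by simp [hc, hw0]
  have hc1 : c 1 = 1 := by simp [hc, hw1]
  -- the intermediate loops `t ↦ (z t, c t • w t)` and `t ↦ (z_far, c t • w t)`
  obtain ⟨δ₁, hδ₁⟩ := exists_path_of_fun
    (a := ⟨ofZW ((50 * ((k : ℝ) + 1) : ℝ) : ℂ) 3, ofZW_zFar_not_mem k 3⟩)
    (b := ⟨ofZW ((50 * ((k : ℝ) + 1) : ℝ) : ℂ) 3, ofZW_zFar_not_mem k 3⟩)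
    (fun t => ofZW (z t) (c t • w t)) (continuous_ofZW' hzc (hcc.smul hwc))
    (by rw [hz0, hc0, hw0, one_smul]) (by rw [hz1, hc1, hw1, one_smul])
    (fun t => not_mem_of_one_lt_norm_w (by rw [wC_ofZW, hnorm]; norm_num))
  obtain ⟨δ₂, hδ₂⟩ := exists_path_of_fun
    (a := ⟨ofZW ((50 * ((k : ℝ) + 1) : ℝ) : ℂ) 3, ofZW_zFar_not_mem k 3⟩)
    (b := ⟨ofZW ((50 * ((k : ℝ) + 1) : ℝ) : ℂ) 3, ofZW_zFar_not_mem k 3⟩)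
    (fun t => ofZW ((50 * ((k : ℝ) + 1) : ℝ) : ℂ) (c t • w t))
    (continuous_ofZW' continuous_const (hcc.smul hwc)) (by rw [hc0, hw0, one_smul])
    (by rw [hc1, hw1, one_smul]) (fun t => ofZW_zFar_not_mem k _)
  have h01 : δ.Homotopic δ₁ := by
    refine homotopic_of_ambient
      (fun q => ofZW (z q.2) (((1 - (q.1 : ℝ)) + (q.1 : ℝ) * c q.2) • w q.2))
      (continuous_ofZW' (hzc.comp continuous_snd)
        (((continuous_const.sub continuous_coe_fst).add
          (continuous_coe_fst.mul (hcc.comp continuous_snd))).smul (hwc.comp continuous_snd)))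
      (fun t => by simp [hδt]) (fun t => by simp [hδ₁]) (fun s => ?_) (fun s => ?_) (fun q => ?_)
    · rw [hz0, hc0, hw0, mul_one, sub_add_cancel, one_smul]
    · rw [hz1, hc1, hw1, mul_one, sub_add_cancel, one_smul]
    · obtain ⟨s, t⟩ := q
      have hl : 0 ≤ (1 - (s : ℝ)) + (s : ℝ) * c t :=
        add_nonneg (unitInterval.one_minus_nonneg s) (mul_nonneg s.2.1 (hcpos t).le)
      have hn : ‖((1 - (s : ℝ)) + (s : ℝ) * c t) • w t‖ = (1 - (s : ℝ)) * ‖w t‖ + 3 * s := by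
        rw [norm_smul, Real.norm_eq_abs, abs_of_nonneg hl, hc, add_mul, mul_assoc,
          div_mul_cancel₀ _ (hpos t).ne']
        ring
      by_cases hr : ‖w t‖ ≤ 3
      · -- below height `3` the push only raises `|w|`: use upward closedness
        refine not_mem_mono (δ t).2 (by simp [hz]) ?_
        rw [wC_ofZW, hn]
        change ‖w t‖ ≤ _
        nlinarith [mul_nonneg s.2.1 (sub_nonneg.2 hr)]
      · -- above height `3` the push stays above height `3 > 1`
        refine not_mem_of_one_lt_norm_w ?_
        rw [wC_ofZW, hn]
        nlinarith [mul_nonneg (unitInterval.one_minus_nonneg s) (sub_nonneg.2 (not_le.1 hr).le)]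
  have h12 : δ₁.Homotopic δ₂ := by
    refine homotopic_of_ambient
      (fun q => ofZW ((1 - (q.1 : ℝ)) • z q.2 + (q.1 : ℝ) • ((50 * ((k : ℝ) + 1) : ℝ) : ℂ))
        (c q.2 • w q.2))
      (continuous_ofZW' (((continuous_const.sub continuous_coe_fst).smul
        (hzc.comp continuous_snd)).add (continuous_coe_fst.smul continuous_const))
        ((hcc.comp continuous_snd).smul (hwc.comp continuous_snd)))
      (fun t => by simp [hδ₁]) (fun t => by simp [hδ₂]) (fun s => ?_) (fun s => ?_)
      (fun q => not_mem_of_one_lt_norm_w (by rw [wC_ofZW, hnorm]; norm_num))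
    · rw [hz0, hc0, hw0, ← add_smul, sub_add_cancel, one_smul, one_smul]
    · rw [hz1, hc1, hw1, ← add_smul, sub_add_cancel, one_smul, one_smul]
  have h23 : δ₂.Homotopic (Path.refl _) := by
    refine homotopic_of_ambient
      (fun q => ofZW ((50 * ((k : ℝ) + 1) : ℝ) : ℂ)
        ((1 - (q.1 : ℝ)) • (c q.2 • w q.2) + (q.1 : ℝ) • (3 : ℂ)))
      (continuous_ofZW' continuous_const
        (((continuous_const.sub continuous_coe_fst).smul
          ((hcc.comp continuous_snd).smul (hwc.comp continuous_snd))).add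
          (continuous_coe_fst.smul continuous_const)))
      (fun t => by simp [hδ₂]) (fun t => by simp) (fun s => ?_) (fun s => ?_)
      (fun q => ofZW_zFar_not_mem k _)
    · rw [hc0, hw0, one_smul, ← add_smul, sub_add_cancel, one_smul]
    · rw [hc1, hw1, one_smul, ← add_smul, sub_add_cancel, one_smul]
  exact (h01.trans h12).trans h23

/-! ## Assembly -/

/-- **`ℝ⁴ ∖ D_k` is simply connected** (van Kampen, easy half, for the cover `U ∪ V` of part 1 and
the two loop-killing lemmas above). [folklore] -/
theorem simplyConnectedSpace_compl_modelHandlebody (k : ℕ) :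
    SimplyConnectedSpace ↥(modelHandlebody k)ᶜ := by
  obtain ⟨hUo, hVo, hUV, hUpc, hVpc, hmeet⟩ := helper_friendsPi1_G1_cover k
  refine simplyConnectedSpace_of_isOpen_cover_of_loops (hUo.preimage continuous_subtype_val)
    (hVo.preimage continuous_subtype_val) ?_
    (x₀ := ⟨ofZW ((50 * ((k : ℝ) + 1) : ℝ) : ℂ) 3, ofZW_zFar_not_mem k 3⟩) xFar_mem_USet
    xFar_mem_VSet (hUpc.preimage_coe USet_subset) (hVpc.preimage_coe VSet_subset)
    (fun δ hδ => loopU_null δ hδ) (fun δ hδ => loopV_null δ hδ) ?_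
  · ext x
    simp only [mem_union, mem_preimage, mem_univ, iff_true]
    have hx : (x : EuclideanSpace ℝ (Fin 4)) ∈
        {x : EuclideanSpace ℝ (Fin 4) | x ∉ modelHandlebody k ∧ wC x ≠ 0} ∪
          {x : EuclideanSpace ℝ (Fin 4) | ofZW (zC x) 0 ∉ modelHandlebody k ∨ 2 < (wC x).re} := by
      rw [hUV]; exact x.2
    exact hx
  · rw [← preimage_inter]
    exact hmeet.preimage_coe (inter_subset_left.trans USet_subset)

/-- **`ℝ⁴ ∖ D_k` is simply connected** — registered helper `helper_friendsPi1_G1` (sub-goal G1 of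
stub `stub_friendsPi1`, line `mk_friends`): the complement of the model dotted handlebody
`D_k = {guard ∧ G_k ≤ 1} ⊂ ℝ⁴`, as the subtype `{x // x ∉ D_k}`, is simply connected. [folklore] -/
theorem helper_friendsPi1_G1 : ∀ (k : ℕ), SimplyConnectedSpace {x : EuclideanSpace ℝ (Fin 4) // x ∉ Literature.Topology.FourManifolds.MMSW.modelHandlebody k} :=
  fun k => simplyConnectedSpace_compl_modelHandlebody k

end Summit.SmoothPoincare4.SmoothPoincare4.Theorems.DcrGap.MkFriends

end
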